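import Mathlib.Analysis.SpecificLimits.Basic
import Literature.NumberTheory.LFunctions.GaussianHeckePrimeSums
import Literature.NumberTheory.DiophantineApproximation.WeylCriterionArcs
import HarnessLib

/-!
# Hecke's theorem: Gaussian primes are equidistributed in sectors — the proof

Topic `Literature/NumberTheory/LFunctions`.  Final brick: we DISCHARGE the named fact
`Literature.NumberTheory.LFunctions.GaussianInt.hecke_gaussianPrimes_inSectors`
(`GaussianPrimesInSectors.lean`; Hecke 1920, §7 (52) specialised in §9 to `ℚ(i)`):

  `#{π Gaussian prime : N(π) ≤ x, arg π ∈ [β, β + α) mod 2π} ∼ (2α/π) · x / log x`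

for every `β` and `0 < α ≤ 2π` (`hecke_gaussianPrimes_inSectors_holds`).  Everything is proved.

## Assembly

* Prime ELEMENTS of norm `≤ N` are the `4 · #(primesQ1 N)` associates `u π` (`u ∈ {±1, ±i}`,
  `π ∈ primesQ1 N`, `sum_primesAll_eq`), so Weyl sums factor:
  `∑_{z prime, N z ≤ N} e^{ik arg z} = (∑_u u^k) ∑_π (π/|π|)^k`, and `∑_u u^k = 4·[4 ∣ k]`
  (`unitSum_eq`); for `k = 4m ≠ 0` the inner sum is `∑_π λ^m(π)` (or its conjugate), which is
  `o(N / log N) = o(#primes)` by `log_mul_sum_angularChar_isLittleO` (`GaussianHeckePrimeSums.lean`).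
* Weyl's criterion for arcs (`WeylCircle.tendsto_card_arc_div`, `WeylCriterionArcs.lean`) gives
  `primeSectorCount β α N / (4 #(primesQ1 N)) → α / 2π`, and `#(primesQ1 N) ∼ N / log N`
  (`card_primesQ1_mul_log_sub_isLittleO`) gives `∼ (2α/π) N / log N` along `ℕ`;
* finally `primeSectorCount β α x = primeSectorCount β α ⌊x⌋₊` and
  `⌊x⌋₊ / log ⌊x⌋₊ ∼ x / log x`.

## References

* E. Hecke, *Eine neue Art von Zetafunktionen und ihre Beziehungen zur Verteilung der
  Primzahlen. II*, Math. Z. 6 (1920), 11–51, §7 (52), §9 p. 46. [HeckeMathZ1920]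
-/

noncomputable section

open Complex Filter Topology Asymptotics Finset

namespace Literature.NumberTheory.LFunctions

namespace GaussianHecke

open GaussianInt GaussianTheta
open Literature.NumberTheory.QuadraticFields.GaussianPrimary (eq_of_isUnit)

local notation "ℤ[i]" => _root_.GaussianInt

open scoped Classical

/-! ### Prime elements as associates of first-quadrant primes -/

/-- The four units of `ℤ[i]` as a finset. [folklore] -/
def unitsFinset : Finset ℤ[i] := {1, -1, ⟨0, 1⟩, ⟨0, -1⟩}

/-- `u ∈ unitsFinset ↔ u` is a unit. [folklore] -/
theorem mem_unitsFinset_iff {u : ℤ[i]} : u ∈ unitsFinset ↔ IsUnit u := by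
  constructor
  · intro hu
    simp only [unitsFinset, mem_insert, mem_singleton] at hu
    refine isUnit_iff_norm_eq_one.mpr ?_
    rcases hu with rfl | rfl | rfl | rfl <;> decide
  · intro hu
    simp only [unitsFinset, mem_insert, mem_singleton]
    exact eq_of_isUnit hu

/-- The prime ELEMENTS of `ℤ[i]` of norm `≤ N` (all four associates of each). [folklore] -/
def primesAll (N : ℕ) : Finset ℤ[i] := (normLE (N : ℝ)).filter Prime

/-- A unit multiple of a prime is prime. [folklore] -/
theorem prime_unit_mul {u π : ℤ[i]} (hu : IsUnit u) (hπ : Prime π) : Prime (u * π) := by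
  obtain ⟨v, rfl⟩ := hu
  exact (Associated.prime ⟨v, mul_comm π v⟩ hπ)

/-- **`∑_{z prime, N z ≤ N} f(z) = ∑_{π ∈ primesQ1 N} ∑_{u unit} f(u π)`**: the prime elements of norm
`≤ N` are exactly the `4 #(primesQ1 N)` distinct associates of the first-quadrant primes. [folklore] -/
theorem sum_primesAll_eq (N : ℕ) (f : ℤ[i] → ℂ) :
    ∑ z ∈ primesAll N, f z = ∑ π ∈ primesQ1 N, ∑ u ∈ unitsFinset, f (u * π) := by
  have hinj : Set.InjOn (fun p : ℤ[i] × ℤ[i] ↦ p.2 * p.1) ↑(primesQ1 N ×ˢ unitsFinset) := by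
    rintro ⟨π, u⟩ hp ⟨π', u'⟩ hp' (h : u * π = u' * π')
    obtain ⟨hπ, hu⟩ := mem_product.mp hp
    obtain ⟨hπ', hu'⟩ := mem_product.mp hp'
    obtain ⟨hP, hQ, -⟩ := mem_primesQ1.mp hπ
    obtain ⟨hP', hQ', -⟩ := mem_primesQ1.mp hπ'
    obtain ⟨v, rfl⟩ := mem_unitsFinset_iff.mp hu
    obtain ⟨v', rfl⟩ := mem_unitsFinset_iff.mp hu'
    have hassoc : Associated π π' := by
      refine ⟨v * v'⁻¹, ?_⟩
      calc π * ↑(v * v'⁻¹) = ↑v'⁻¹ * (↑v * π) := by push_cast; ring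
        _ = ↑v'⁻¹ * (↑v' * π') := by rw [h]
        _ = π' := by rw [← mul_assoc, Units.inv_mul, one_mul]
    have hππ : π = π' := eq_of_associated hassoc hQ hQ'
    subst hππ
    have : (v : ℤ[i]) = v' := mul_right_cancel₀ hP.ne_zero h
    rw [this]
  have himage : (primesQ1 N ×ˢ unitsFinset).image (fun p : ℤ[i] × ℤ[i] ↦ p.2 * p.1) = primesAll N := by
    ext z
    simp only [mem_image, mem_product, primesAll, mem_filter, mem_normLE, Prod.exists]
    constructor
    · rintro ⟨π, u, ⟨hπ, hu⟩, rfl⟩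
      obtain ⟨hP, -, hle⟩ := mem_primesQ1.mp hπ
      have hu' := mem_unitsFinset_iff.mp hu
      refine ⟨?_, prime_unit_mul hu' hP⟩
      rw [Zsqrtd.norm_mul, isUnit_iff_norm_eq_one.mp hu', one_mul]
      exact_mod_cast hle
    · rintro ⟨hle, hz⟩
      obtain ⟨v, hv, hq⟩ := exists_q1_eq_mul z
      obtain ⟨w, hw⟩ := hv.exists_left_inv
      refine ⟨q1 z, w, ⟨mem_primesQ1.mpr ⟨prime_q1 hz, q1_mem hz.ne_zero, ?_⟩,
        mem_unitsFinset_iff.mpr (IsUnit.of_mul_eq_one v hw)⟩, ?_⟩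
      · rw [norm_q1]; exact_mod_cast hle
      · rw [hq, ← mul_assoc, hw, one_mul]
  rw [← himage, sum_image hinj, sum_product]

/-- `#(primesAll N) = 4 #(primesQ1 N)`. [folklore] -/
theorem card_primesAll (N : ℕ) : (primesAll N).card = 4 * (primesQ1 N).card := by
  have h := sum_primesAll_eq N (fun _ ↦ 1)
  simp only [sum_const, nsmul_eq_mul, mul_one] at h
  have hU : unitsFinset.card = 4 := by decide
  rw [hU] at h
  exact_mod_cast (by rw [h]; push_cast; ring : ((primesAll N).card : ℂ) = ((4 * (primesQ1 N).card : ℕ) : ℂ))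

/-! ### Characters `(z/|z|)^k` and the unit sums -/

/-- `χ_k(z) = (z/|z|)^k`, `k ∈ ℤ`. [folklore] -/
def chi (k : ℤ) (z : ℤ[i]) : ℂ := ((z : ℂ) / (‖(z : ℂ)‖ : ℂ)) ^ k

/-- `χ_k(z) = e^{ik arg z}` for `z ≠ 0`. [folklore] -/
theorem chi_eq_exp (k : ℤ) {z : ℤ[i]} (hz : z ≠ 0) : chi k z = cexp (k * arg (z : ℂ) * I) := by
  have hz' : (z : ℂ) ≠ 0 := fun h ↦ hz (GaussianInt.toComplex_eq_zero.mp h)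
  have hn : (‖(z : ℂ)‖ : ℂ) ≠ 0 := by exact_mod_cast norm_ne_zero_iff.mpr hz'
  rw [chi, mul_assoc, Complex.exp_int_mul]
  congr 1
  rw [eq_comm, eq_div_iff hn, mul_comm]
  exact Complex.norm_mul_exp_arg_mul_I _

/-- The units, as complex numbers, have norm `1`, and `χ_k(u z) = u^k χ_k(z)`. [folklore] -/
theorem chi_unit_mul (k : ℤ) {u : ℤ[i]} (hu : IsUnit u) (z : ℤ[i]) :
    chi k (u * z) = (u : ℂ) ^ k * chi k z := by
  have hnu : ‖(u : ℂ)‖ = 1 := by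
    rw [GaussianTheta.norm_toComplex, isUnit_iff_norm_eq_one.mp hu]; simp
  rw [chi, chi, GaussianInt.toComplex_mul, norm_mul, hnu, one_mul, mul_div_assoc, mul_zpow]

/-- `∑_{u unit} u^k = (1 + (-1)^k)(1 + i^k)`. [folklore] -/
theorem unitSum_eq (k : ℤ) : ∑ u ∈ unitsFinset, ((u : ℤ[i]) : ℂ) ^ k = (1 + (-1) ^ k) * (1 + I ^ k) := by
  have hI : (((⟨0, 1⟩ : ℤ[i]) : ℂ)) = I := by rw [GaussianInt.toComplex_def']; push_cast; ring
  have hI' : (((⟨0, -1⟩ : ℤ[i]) : ℂ)) = -I := by rw [GaussianInt.toComplex_def']; push_cast; ring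
  rw [unitsFinset, sum_insert (by decide), sum_insert (by decide), sum_insert (by decide), sum_singleton,
    map_one, map_neg, map_one, hI, hI', show (-I : ℂ) = (-1) * I by ring, mul_zpow, one_zpow]
  ring

/-- `∑_{u unit} u^k = 4` if `4 ∣ k`. [folklore] -/
theorem unitSum_of_dvd {k : ℤ} (hk : (4 : ℤ) ∣ k) : ∑ u ∈ unitsFinset, ((u : ℤ[i]) : ℂ) ^ k = 4 := by
  obtain ⟨q, rfl⟩ := hk
  have h1 : ((-1 : ℂ)) ^ (4 : ℤ) = 1 := by
    rw [show (4 : ℤ) = ((4 : ℕ) : ℤ) by norm_num, zpow_natCast]; norm_num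
  have h2 : (I : ℂ) ^ (4 : ℤ) = 1 := by
    rw [show (4 : ℤ) = ((4 : ℕ) : ℤ) by norm_num, zpow_natCast, I_pow_four]
  rw [unitSum_eq, zpow_mul, zpow_mul, h1, h2, one_zpow]
  norm_num

/-- `∑_{u unit} u^k = 0` unless `4 ∣ k`. [folklore] -/
theorem unitSum_of_not_dvd {k : ℤ} (hk : ¬(4 : ℤ) ∣ k) : ∑ u ∈ unitsFinset, ((u : ℤ[i]) : ℂ) ^ k = 0 := by
  rw [unitSum_eq]
  rcases Int.even_or_odd k with ⟨j, hj⟩ | hodd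
  · have hjodd : Odd j := by
      rcases Int.even_or_odd j with ⟨i, hi⟩ | h
      · exact absurd ⟨i, by rw [hj, hi]; ring⟩ hk
      · exact h
    have hIk : I ^ k = -1 := by
      rw [hj, ← two_mul, zpow_mul, show (I : ℂ) ^ (2 : ℤ) = -1 by rw [zpow_two, I_mul_I],
        hjodd.neg_one_zpow]
    rw [hIk]
    ring
  · rw [hodd.neg_one_zpow]
    ring

/-- **Factorisation of the Weyl sums over prime elements**:
`∑_{z prime, N z ≤ N} χ_k(z) = (∑_u u^k) · ∑_{π ∈ primesQ1 N} χ_k(π)`. [folklore] -/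
theorem sum_chi_primesAll (k : ℤ) (N : ℕ) :
    ∑ z ∈ primesAll N, chi k z = (∑ u ∈ unitsFinset, ((u : ℤ[i]) : ℂ) ^ k) * ∑ π ∈ primesQ1 N, chi k π := by
  rw [sum_primesAll_eq, mul_sum]
  refine sum_congr rfl fun π _ ↦ ?_
  rw [sum_mul]
  exact sum_congr rfl fun u hu ↦ chi_unit_mul k (mem_unitsFinset_iff.mp hu) π

/-- `χ_{4m} = λ^m` (`m ∈ ℕ`). [folklore] -/
theorem chi_four_mul (m : ℕ) (z : ℤ[i]) : chi (4 * (m : ℤ)) z = angularChar m z := by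
  rw [chi, angularChar_def, show (4 * (m : ℤ)) = ((4 * m : ℕ) : ℤ) by push_cast; ring, zpow_natCast]

/-- `χ_{-4m}(z) = \overline{λ^m(z)}` for `z ≠ 0`. [folklore] -/
theorem chi_neg_four_mul (m : ℕ) {z : ℤ[i]} (hz : z ≠ 0) :
    chi (-(4 * (m : ℤ))) z = starRingEnd ℂ (angularChar m z) := by
  rw [chi, zpow_neg, ← chi, chi_four_mul, Complex.inv_eq_conj (norm_angularChar hz)]

/-! ### The Weyl hypotheses for the prime angles -/

/-- `#(primesQ1 N) log N ∼ N`. [folklore] -/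
theorem isEquivalent_card_primesQ1_mul_log :
    (fun N : ℕ ↦ ((primesQ1 N).card : ℝ) * Real.log N) ~[atTop] fun N : ℕ ↦ (N : ℝ) :=
  card_primesQ1_mul_log_sub_isLittleO

/-- **`∑_{π ∈ primesQ1 N} λ^m(π) = o(#(primesQ1 N))`** for `m ≥ 1`. [cite: HeckeMathZ1920, §7] -/
theorem sum_angularChar_isLittleO_card {m : ℕ} (hm : m ≠ 0) :
    (fun N : ℕ ↦ ∑ π ∈ primesQ1 N, angularChar m π) =o[atTop] fun N : ℕ ↦ ((primesQ1 N).card : ℝ) := by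
  have h1 := (log_mul_sum_angularChar_isLittleO hm).trans_isBigO
    isEquivalent_card_primesQ1_mul_log.symm.isBigO
  -- divide by `log N`
  have h2 : (fun N : ℕ ↦ ((Real.log N : ℂ))⁻¹) =O[atTop] fun N : ℕ ↦ (Real.log N)⁻¹ :=
    IsBigO.of_bound 1 (Eventually.of_forall fun N ↦ by
      rw [norm_inv, norm_inv, Complex.norm_real, one_mul])
  have h3 := h1.mul_isBigO h2
  refine h3.congr' ?_ ?_
  · filter_upwards [eventually_ge_atTop 2] with N hN
    have hlog : (Real.log N : ℂ) ≠ 0 := by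
      exact_mod_cast (Real.log_pos (by exact_mod_cast hN)).ne'
    field_simp
  · filter_upwards [eventually_ge_atTop 2] with N hN
    have hlog : Real.log N ≠ 0 := (Real.log_pos (by exact_mod_cast hN)).ne'
    field_simp

/-- **The Weyl sums of the Gaussian prime angles are `o(#primes)`**: for every integer `k ≠ 0`,
`∑_{z prime, N z ≤ N} e^{ik arg z} = o(#{z prime : N z ≤ N})` (they vanish identically unless
`4 ∣ k`, and for `k = ±4m` reduce to `4 ∑_π λ^m(π)`, resp. its conjugate). [cite: HeckeMathZ1920, §7] -/
theorem weylSum_primes_isLittleO {k : ℤ} (hk : k ≠ 0) :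
    (fun N : ℕ ↦ ∑ z ∈ primesAll N, cexp (k * arg (z : ℂ) * I)) =o[atTop]
      fun N : ℕ ↦ ((primesAll N).card : ℝ) := by
  have heq : ∀ N, ∑ z ∈ primesAll N, cexp (k * arg (z : ℂ) * I) = ∑ z ∈ primesAll N, chi k z :=
    fun N ↦ sum_congr rfl fun z hz ↦ (chi_eq_exp k (mem_filter.mp hz).2.ne_zero).symm
  simp_rw [heq, sum_chi_primesAll, card_primesAll]
  by_cases h4 : (4 : ℤ) ∣ k
  · simp_rw [unitSum_of_dvd h4]
    obtain ⟨q, rfl⟩ := h4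
    obtain ⟨m, hm | hm⟩ := Int.eq_nat_or_neg q
    · subst hm
      have hm0 : m ≠ 0 := by rintro rfl; exact hk (by simp)
      simp_rw [chi_four_mul]
      have h := (sum_angularChar_isLittleO_card hm0).const_mul_left (4 : ℂ)
      refine h.trans_isBigO (IsBigO.of_bound 1 (Eventually.of_forall fun N ↦ ?_))
      rw [Real.norm_natCast, Real.norm_natCast, one_mul]; push_cast; linarith
    · subst hm
      have hm0 : m ≠ 0 := by rintro rfl; exact hk (by simp)
      have hconj : ∀ N, ∑ π ∈ primesQ1 N, chi (4 * -(m : ℤ)) π =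
          starRingEnd ℂ (∑ π ∈ primesQ1 N, angularChar m π) := by
        intro N
        rw [map_sum]
        refine sum_congr rfl fun π hπ ↦ ?_
        rw [mul_neg, chi_neg_four_mul m (mem_primesQ1.mp hπ).1.ne_zero]
      simp_rw [hconj]
      have h := (sum_angularChar_isLittleO_card hm0)
      have h' : (fun N : ℕ ↦ starRingEnd ℂ (∑ π ∈ primesQ1 N, angularChar m π)) =o[atTop]
          fun N : ℕ ↦ ((primesQ1 N).card : ℝ) :=
        IsLittleO.of_norm_left (h.norm_left.congr_left fun N ↦ (Complex.norm_conj _).symm)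
      refine (h'.const_mul_left (4 : ℂ)).trans_isBigO (IsBigO.of_bound 1 (Eventually.of_forall fun N ↦ ?_))
      rw [Real.norm_natCast, Real.norm_natCast, one_mul]; push_cast; linarith
  · simp_rw [unitSum_of_not_dvd h4, zero_mul]
    exact isLittleO_zero _ _

/-- `#(primesQ1 N) → ∞`. [folklore] -/
theorem tendsto_card_primesQ1_atTop : Tendsto (fun N : ℕ ↦ (primesQ1 N).card) atTop atTop := by
  rw [← tendsto_natCast_atTop_iff (R := ℝ)]
  refine tendsto_atTop.mpr fun b ↦ ?_
  have hb : 0 < max b 1 := lt_max_of_lt_right one_pos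
  -- `P log N ≥ N/2` and `log N ≤ N / (2 max b 1)` eventually
  have h1 := isEquivalent_card_primesQ1_mul_log.isLittleO.def (by norm_num : (0 : ℝ) < 1 / 2)
  have h2 := (Real.isLittleO_log_id_atTop.comp_tendsto tendsto_natCast_atTop_atTop).def
    (by positivity : (0 : ℝ) < 1 / (2 * max b 1))
  filter_upwards [h1, h2, eventually_ge_atTop 2] with N hN1 hN2 hN
  have hN0 : (0 : ℝ) < N := by exact_mod_cast (by omega : 0 < N)
  have hlog : 0 < Real.log N := Real.log_pos (by exact_mod_cast (by omega : 1 < N))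
  simp only [Pi.sub_apply, Function.comp_apply, id_eq, Real.norm_eq_abs, abs_of_pos hN0,
    abs_of_pos hlog] at hN1 hN2
  rw [abs_le] at hN1
  -- `max b 1 · log N ≤ N/2 ≤ P log N`
  have hb' : max b 1 ≠ 0 := hb.ne'
  have h3 : max b 1 * Real.log N ≤ N / 2 := by
    have key : max b 1 * (1 / (2 * max b 1) * (N : ℝ)) = N / 2 := by field_simp
    rw [← key]
    exact mul_le_mul_of_nonneg_left hN2 hb.le
  have h4 : (N : ℝ) / 2 ≤ (primesQ1 N).card * Real.log N := by linarith [hN1.1]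
  have h6 : max b 1 ≤ (primesQ1 N).card := le_of_mul_le_mul_right (h3.trans h4) hlog
  exact le_trans (le_max_left _ _) h6

/-- `#{z prime : N z ≤ N} → ∞`. [folklore] -/
theorem tendsto_card_primesAll_atTop : Tendsto (fun N : ℕ ↦ (primesAll N).card) atTop atTop := by
  simp_rw [card_primesAll]
  exact tendsto_card_primesQ1_atTop.const_mul_atTop' (by norm_num)

/-! ### Sector counts -/

/-- **`primeSectorCount β α N / (4 #(primesQ1 N)) → α / (2π)`** (Weyl's criterion for arcs applied to
the Gaussian prime angles). [cite: HeckeMathZ1920, §7] -/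
theorem tendsto_primeSectorCount_div (β : ℝ) {α : ℝ} (hα : 0 < α) (hα2 : α ≤ 2 * Real.pi) :
    Tendsto (fun N : ℕ ↦ (primeSectorCount β α N : ℝ) / (4 * (primesQ1 N).card)) atTop
      (𝓝 (α / (2 * Real.pi))) := by
  have h := Literature.NumberTheory.DiophantineApproximation.WeylCircle.tendsto_card_arc_div primesAll
    (fun z : ℤ[i] ↦ arg (z : ℂ))
    tendsto_card_primesAll_atTop (fun k hk ↦ weylSum_primes_isLittleO hk) β hα hα2
  refine h.congr fun N ↦ ?_
  rw [card_primesAll, primeSectorCount, primesAll, Finset.filter_filter]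
  push_cast
  rfl

/-- `#(primesQ1 N) ∼ N / log N`. [folklore] -/
theorem isEquivalent_card_primesQ1 :
    (fun N : ℕ ↦ ((primesQ1 N).card : ℝ)) ~[atTop] fun N : ℕ ↦ (N : ℝ) / Real.log N := by
  have h := isEquivalent_card_primesQ1_mul_log.div (IsEquivalent.refl (u := fun N : ℕ ↦ Real.log N))
  refine h.congr_left ?_
  filter_upwards [eventually_ge_atTop 2] with N hN
  have hlog : Real.log N ≠ 0 := (Real.log_pos (by exact_mod_cast hN)).ne'
  simp only [Pi.div_apply]
  field_simp

/-- **Hecke's theorem along the integers**: `primeSectorCount β α N ∼ (2α/π) N / log N`.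
[cite: HeckeMathZ1920, §7 (52), §9] -/
theorem primeSectorCount_nat_isEquivalent (β : ℝ) {α : ℝ} (hα : 0 < α) (hα2 : α ≤ 2 * Real.pi) :
    (fun N : ℕ ↦ (primeSectorCount β α N : ℝ)) ~[atTop]
      fun N : ℕ ↦ 2 * α / Real.pi * (N / Real.log N) := by
  have hπ := Real.pi_pos
  have hc : 0 < α / (2 * Real.pi) := by positivity
  -- `count ∼ (α/2π) · 4 #primesQ1`
  have h1 : (fun N : ℕ ↦ (primeSectorCount β α N : ℝ)) ~[atTop]
      fun N : ℕ ↦ α / (2 * Real.pi) * (4 * (primesQ1 N).card) := by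
    refine isEquivalent_of_tendsto_one ?_
    have h := (tendsto_primeSectorCount_div β hα hα2).div_const (α / (2 * Real.pi))
    rw [div_self hc.ne'] at h
    refine h.congr fun N ↦ ?_
    simp only [Pi.div_apply]
    rw [div_div, mul_comm]
  -- `(α/2π) · 4 #primesQ1 ∼ (α/2π) · 4 · N/log N = (2α/π) N/log N`
  have h2 : (fun N : ℕ ↦ α / (2 * Real.pi) * (4 * ((primesQ1 N).card : ℝ))) ~[atTop]
      fun N : ℕ ↦ α / (2 * Real.pi) * (4 * ((N : ℝ) / Real.log N)) :=
    IsEquivalent.refl.mul (IsEquivalent.refl.mul isEquivalent_card_primesQ1)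
  refine (h1.trans h2).congr_right (Eventually.of_forall fun N ↦ ?_)
  field_simp
  ring

/-- `primeSectorCount β α x` only depends on `⌊x⌋` (norms are integers). [folklore] -/
theorem primeSectorCount_eq_floor (β α : ℝ) {x : ℝ} (hx : 0 ≤ x) :
    primeSectorCount β α x = primeSectorCount β α ((⌊x⌋₊ : ℕ) : ℝ) := by
  have hset : normLE x = normLE ((⌊x⌋₊ : ℕ) : ℝ) := by
    ext z
    rw [mem_normLE, mem_normLE]
    constructor
    · intro h
      have h1 : z.norm ≤ ⌊x⌋ := Int.le_floor.mpr h
      have h2 : (⌊x⌋₊ : ℤ) = ⌊x⌋ := Int.natCast_floor_eq_floor hx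
      have h3 : z.norm ≤ (⌊x⌋₊ : ℤ) := by rw [h2]; exact h1
      exact_mod_cast h3
    · intro h
      exact h.trans (Nat.floor_le hx)
  unfold primeSectorCount
  rw [hset]

/-- `log ⌊x⌋₊ ∼ log x`. [folklore] -/
theorem isEquivalent_log_floor :
    (fun x : ℝ ↦ Real.log (⌊x⌋₊ : ℝ)) ~[atTop] fun x : ℝ ↦ Real.log x := by
  -- `log ⌊x⌋ - log x = log (⌊x⌋/x) → 0`, and `1 = O(log x)`
  have h1 : Tendsto (fun x : ℝ ↦ Real.log ((⌊x⌋₊ : ℝ) / x)) atTop (𝓝 0) := by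
    have := ((Real.continuousAt_log one_ne_zero).tendsto.comp (tendsto_nat_floor_div_atTop (R := ℝ)))
    rwa [Real.log_one] at this
  have h2 : (fun x : ℝ ↦ Real.log (⌊x⌋₊ : ℝ) - Real.log x) =o[atTop] fun _ : ℝ ↦ (1 : ℝ) := by
    rw [isLittleO_one_iff]
    refine h1.congr' ?_
    filter_upwards [eventually_ge_atTop 1] with x hx
    rw [Real.log_div (by exact_mod_cast (Nat.floor_pos.mpr hx).ne') (by linarith)]
  have h3 : (fun _ : ℝ ↦ (1 : ℝ)) =O[atTop] fun x : ℝ ↦ Real.log x := by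
    refine IsBigO.of_bound 1 ?_
    filter_upwards [eventually_ge_atTop (Real.exp 1)] with x hx
    rw [norm_one, one_mul, Real.norm_eq_abs, abs_of_pos (Real.log_pos (by linarith [Real.add_one_lt_exp one_ne_zero]))]
    rwa [Real.le_log_iff_exp_le (by linarith [Real.exp_pos 1])]
  exact h2.trans_isBigO h3

/-- **Hecke's theorem**: `primeSectorCount β α x ∼ (2α/π) x / log x` as `x → ∞`, for every `β` and
`0 < α ≤ 2π`. [cite: HeckeMathZ1920, §7 (52), §9] -/
theorem primeSectorCount_isEquivalent (β : ℝ) {α : ℝ} (hα : 0 < α) (hα2 : α ≤ 2 * Real.pi) :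
    (fun x : ℝ ↦ (primeSectorCount β α x : ℝ)) ~[atTop] fun x : ℝ ↦ 2 * α / Real.pi * (x / Real.log x) := by
  have hN := primeSectorCount_nat_isEquivalent β hα hα2
  have h1 : (fun x : ℝ ↦ (primeSectorCount β α x : ℝ)) =ᶠ[atTop]
      ((fun N : ℕ ↦ (primeSectorCount β α N : ℝ)) ∘ fun x : ℝ ↦ ⌊x⌋₊) := by
    filter_upwards [eventually_ge_atTop 0] with x hx
    simp only [Function.comp_apply, primeSectorCount_eq_floor β α hx]
  have h2 := hN.comp_tendsto (tendsto_nat_floor_atTop (α := ℝ))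
  have hfl : (fun x : ℝ ↦ (⌊x⌋₊ : ℝ)) ~[atTop] fun x : ℝ ↦ x := by
    refine isEquivalent_of_tendsto_one ?_
    exact tendsto_nat_floor_div_atTop (R := ℝ)
  have h3 : ((fun N : ℕ ↦ 2 * α / Real.pi * (N / Real.log N)) ∘ fun x : ℝ ↦ ⌊x⌋₊) ~[atTop]
      fun x : ℝ ↦ 2 * α / Real.pi * (x / Real.log x) :=
    IsEquivalent.refl.mul (hfl.div isEquivalent_log_floor)
  exact ((h2.trans h3).congr_left h1.symm)

end GaussianHecke

/-! ### The discharge -/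

namespace GaussianInt

/-- **Hecke 1920: Gaussian primes are equidistributed in sectors** — discharge of the named fact
`hecke_gaussianPrimes_inSectors`: for every `β` and `0 < α ≤ 2π`,
`#{π Gaussian prime : N π ≤ x, arg π ∈ [β, β + α) mod 2π} ∼ (2α/π) · x / log x`.
Proof: Hecke `L`-functions `L(s, λ^m)` of `ℚ(i)` (theta series and analytic continuation,
`GaussianHeckeThetaFE`/`ThetaMellin`), `-L'/L` via unique factorisation in `ℤ[i]`
(`GaussianHeckeVonMangoldt`/`LSeries`), non-vanishing on `Re s = 1` (`GaussianHeckeNonvanishing`),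
Wiener–Ikehara (`GaussianHeckeTauberian`, the tree's `WienerIkehara_holds`), partial summation
(`GaussianHeckePrimeSums`) and Weyl's criterion for arcs (`WeylCriterionArcs`).
[cite: HeckeMathZ1920, §7 (52) and §9 p. 46] -/
theorem hecke_gaussianPrimes_inSectors_holds : hecke_gaussianPrimes_inSectors :=
  fun β _α hα hα2 ↦ GaussianHecke.primeSectorCount_isEquivalent β hα hα2

end GaussianInt



end Literature.NumberTheory.LFunctions
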